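import Summits.Ventures.QEC.Census.GB.UB42_UB26
import Summits.Ventures.QEC.Census.GB.UB60_UB26
import Summits.Ventures.QEC.Census.BB.BBRows
import Summits.Ventures.QEC.Census.BB.Claims
import Literature.InformationTheory.QuantumCodes.UnivariateBicycleCodes
import Literature.InformationTheory.QuantumCodes.CSSParameters
import HarnessLib

/-!
# The two printed univariate-bicycle codes of Rabeti–Mahdavifar 2026 hold EXACTLY on the typed objects:
# `[[42, 8, 5]]` for `BB.ub42` and `[[60, 8, 5]]` for `BB.ub60` (tier KERNEL)

`BB.ub42 = UB(1 + x + x² + x⁴, 1)` over `𝓡₂₁` and `BB.ub60 = UB(1 + x + x³ + x⁴, 5)` over `𝓡₃₀` are the two instances printed in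
[RabetiMahdavifar2026] (arXiv:2605.14173, Example 1 chunk p0007 L202–205 `[[42,8,5]]`; §4 chunk p0008 L9–24 `[[60,8,5]]`,
"`d = ⌊B₃^X⌋ = ⌊5.0897⌋`"), typed in `Literature/InformationTheory/QuantumCodes/UnivariateBicycleCodes.lean` (p562343:
`BB.ub`, `BB.frobScale`, `ub42_B : ub42.B = 1 + x² + x⁴ + x⁸`, `ub60_B : ub60.B = 1 + x² + x⁶ + x⁸`).  The qec census certified
the SAME matrices as the explicit codes of rows `UB42_UB26` / `UB60_UB26` (generator files `census/search-2/gens/ub26/*.json`, built by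
qec-search-2 g5 with the literal `BB(ℓ,1)` index convention of Bravyi et al. §4 = `BivariateBicycleCodes.lean`; kernel A certA
90f74a0de7c16b6f / 667700e6eaaf8bce (qec-search-1), kernel B certB 725f5f07257474a7 / 7a0eb659cd9546d0 (qec-search-2, in-seat SAT + LRAT),
ref-1 signed; KERNEL-std one-module orbit certificates `Census/GB/UB42_UB26.lean` p563919 and `Census/GB/UB60_UB26.lean` p564289,
qec-search-3 g8: `UB42_UB26.isCode : (cert.code _).IsCode 42 8 5`, `UB60_UB26.isCode : … IsCode 60 8 5`).

This file reads those rows as statements about the typed constructions (qec-type-05 bridge pattern, as `Census/GB/PK21A3.lean`):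
monomial lists; `BB.ub42.A/B = polyL …` (`decide +kernel` on the 21 / 30 coefficients — `B` is Lemma 2's `a(x^{2^ℓ})`); the kernel INDEX
IDENTITIES `UB42_UB26.cert.HX = BBRows.rowsX la lb` etc. (`decide +kernel`; list-identical, checked in Python before filing); the flat
identities via `BBRows.rowMatrix_rowsX/Z`; transport of `dZ_eq` / `k_eq` by `BB.Code.dZ_eq_of_flat` / `k_eq_of_flat`; assembled as
**`UB42_8_5_holds : BB.HasParams BB.ub42 42 8 5`** and **`UB60_8_5_holds : BB.HasParams BB.ub60 60 8 5`** (distance EXACT = printed `5`,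
`Census/BB/Claims.lean` predicate) with `isCode` twins.

No new certificate — tier KERNEL, axioms standard, no `native_decide`. HONEST FRAMING: REPRODUCTIONS of the two printed parameter sets
on the typed objects (the printed values come from the authors' library computation / their bound `B₃^X`; ours is an independent
machine-checked certificate chain); no novelty word. qec-search-2 g5.
-/

namespace Summit.Ventures.QEC.Census.UB26Rows

open Matrix Literature.InformationTheory.QuantumCodes BBRows

/-! ## `BB.ub42 = UB(1 + x + x² + x⁴, 1)` over `𝓡₂₁` — `[[42, 8, 5]]` -/

/-- Monomials of `BB.ub42.A = 1 + x + x² + x⁴` on `ℤ₂₁ × ℤ₁`. DATA. -/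
def la42 : List (BB.Mono 21 1) := [(Fin.ofNat 21 0, 0), (Fin.ofNat 21 1, 0), (Fin.ofNat 21 2, 0), (Fin.ofNat 21 4, 0)]

/-- Monomials of `BB.ub42.B = a(x²) = 1 + x² + x⁴ + x⁸` on `ℤ₂₁ × ℤ₁`. DATA. -/
def lb42 : List (BB.Mono 21 1) := [(Fin.ofNat 21 0, 0), (Fin.ofNat 21 2, 0), (Fin.ofNat 21 4, 0), (Fin.ofNat 21 8, 0)]

/-- `BB.ub42.A = polyL la42` (coefficientwise, `decide`). -/
theorem ub42_obj_A : BB.ub42.A = polyL la42 := by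
  funext g; revert g; decide +kernel

/-- `BB.ub42.B = polyL lb42` (Lemma 2's `a(x²)`, coefficientwise, `decide`). -/
theorem ub42_obj_B : BB.ub42.B = polyL lb42 := by
  funext g; revert g; decide +kernel

set_option maxRecDepth 100000 in
/-- INDEX IDENTITY, `X` side: the census certificate's `H^X` rows ARE the `X`-check words of `BB.ub42` (`decide +kernel`). -/
theorem ub42_HX_eq_rowsX : UB42_UB26.cert.HX = rowsX la42 lb42 := by
  decide +kernel

set_option maxRecDepth 100000 in
/-- INDEX IDENTITY, `Z` side. -/
theorem ub42_HZ_eq_rowsZ : UB42_UB26.cert.HZ = rowsZ la42 lb42 := by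
  decide +kernel

set_option maxRecDepth 100000 in
/-- The certificate's flat `H^X` is `BB.ub42.HXFlat`. -/
theorem ub42_rowMatrix_HX_eq : rowMatrix 42 UB42_UB26.cert.HX = BB.ub42.HXFlat := by
  have cast : ∀ {H H' : List ℕ} (e : H = H'),
      rowMatrix 42 H = (rowMatrix 42 H').submatrix (Fin.cast (congrArg List.length e)) id := by
    intro H H' e; subst e; rfl
  exact (cast ub42_HX_eq_rowsX).trans (rowMatrix_rowsX BB.ub42 (LA := la42) (LB := lb42) ub42_obj_A ub42_obj_B)

set_option maxRecDepth 100000 in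
/-- The certificate's flat `H^Z` is `BB.ub42.HZFlat`. -/
theorem ub42_rowMatrix_HZ_eq : rowMatrix 42 UB42_UB26.cert.HZ = BB.ub42.HZFlat := by
  have cast : ∀ {H H' : List ℕ} (e : H = H'),
      rowMatrix 42 H = (rowMatrix 42 H').submatrix (Fin.cast (congrArg List.length e)) id := by
    intro H H' e; subst e; rfl
  exact (cast ub42_HZ_eq_rowsZ).trans (rowMatrix_rowsZ BB.ub42 (LA := la42) (LB := lb42) ub42_obj_A ub42_obj_B)

set_option maxRecDepth 100000 in
/-- `d^Z (BB.ub42) = 5`, transported from the census certificate (`UB42_UB26.dZ_eq`) by `BB.Code.dZ_eq_of_flat`. -/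
theorem ub42_dZ : BB.ub42.css.dZ = 5 :=
  (BB.ub42.dZ_eq_of_flat (D := UB42_UB26.cert.code (UB42_UB26.cert.commOK_of_checkStructure UB42_UB26.checkStructure_ok))
    ub42_rowMatrix_HX_eq ub42_rowMatrix_HZ_eq).symm.trans UB42_UB26.dZ_eq

set_option maxRecDepth 100000 in
/-- `k (BB.ub42) = 8`, transported from the census certificate (`UB42_UB26.k_eq`) by `BB.Code.k_eq_of_flat`. -/
theorem ub42_k : BB.ub42.k = 8 :=
  (BB.ub42.k_eq_of_flat (D := UB42_UB26.cert.code (UB42_UB26.cert.commOK_of_checkStructure UB42_UB26.checkStructure_ok))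
    ub42_rowMatrix_HX_eq ub42_rowMatrix_HZ_eq).symm.trans UB42_UB26.k_eq

/-- **Rabeti–Mahdavifar Example 1: `UB(1 + x + x² + x⁴, 1)` over `𝓡₂₁` has parameters `[[42, 8, 5]]`** (distance EXACT;
`BB.HasParams`) — the printed parameters REPRODUCED on the typed object `BB.ub42`. KERNEL. -/
theorem UB42_8_5_holds : Summit.Ventures.QEC.BB.HasParams BB.ub42 42 8 5 :=
  BB.hasParams_of_dZ (by simp only [BB.numQubits_eq]) ub42_k ub42_dZ

/-- The same in the generic census vocabulary: `BB.ub42.css.IsCode 42 8 5`. -/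
theorem ub42_isCode : BB.ub42.css.IsCode 42 8 5 :=
  (BB.hasParams_iff_isCode (by decide)).1 UB42_8_5_holds

/-! ## `BB.ub60 = UB(1 + x + x³ + x⁴, 5)` over `𝓡₃₀` — `[[60, 8, 5]]` -/

/-- Monomials of `BB.ub60.A = 1 + x + x³ + x⁴` on `ℤ₃₀ × ℤ₁`. DATA. -/
def la60 : List (BB.Mono 30 1) := [(Fin.ofNat 30 0, 0), (Fin.ofNat 30 1, 0), (Fin.ofNat 30 3, 0), (Fin.ofNat 30 4, 0)]

/-- Monomials of `BB.ub60.B = a(x³²) = a(x²) = 1 + x² + x⁶ + x⁸` on `ℤ₃₀ × ℤ₁`. DATA. -/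
def lb60 : List (BB.Mono 30 1) := [(Fin.ofNat 30 0, 0), (Fin.ofNat 30 2, 0), (Fin.ofNat 30 6, 0), (Fin.ofNat 30 8, 0)]

/-- `BB.ub60.A = polyL la60`. -/
theorem ub60_obj_A : BB.ub60.A = polyL la60 := by
  funext g; revert g; decide +kernel

/-- `BB.ub60.B = polyL lb60` (Lemma 2's `a(x³²)`). -/
theorem ub60_obj_B : BB.ub60.B = polyL lb60 := by
  funext g; revert g; decide +kernel

set_option maxRecDepth 100000 in
/-- INDEX IDENTITY, `X` side, for `BB.ub60`. -/
theorem ub60_HX_eq_rowsX : UB60_UB26.cert.HX = rowsX la60 lb60 := by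
  decide +kernel

set_option maxRecDepth 100000 in
/-- INDEX IDENTITY, `Z` side, for `BB.ub60`. -/
theorem ub60_HZ_eq_rowsZ : UB60_UB26.cert.HZ = rowsZ la60 lb60 := by
  decide +kernel

set_option maxRecDepth 100000 in
/-- The certificate's flat `H^X` is `BB.ub60.HXFlat`. -/
theorem ub60_rowMatrix_HX_eq : rowMatrix 60 UB60_UB26.cert.HX = BB.ub60.HXFlat := by
  have cast : ∀ {H H' : List ℕ} (e : H = H'),
      rowMatrix 60 H = (rowMatrix 60 H').submatrix (Fin.cast (congrArg List.length e)) id := by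
    intro H H' e; subst e; rfl
  exact (cast ub60_HX_eq_rowsX).trans (rowMatrix_rowsX BB.ub60 (LA := la60) (LB := lb60) ub60_obj_A ub60_obj_B)

set_option maxRecDepth 100000 in
/-- The certificate's flat `H^Z` is `BB.ub60.HZFlat`. -/
theorem ub60_rowMatrix_HZ_eq : rowMatrix 60 UB60_UB26.cert.HZ = BB.ub60.HZFlat := by
  have cast : ∀ {H H' : List ℕ} (e : H = H'),
      rowMatrix 60 H = (rowMatrix 60 H').submatrix (Fin.cast (congrArg List.length e)) id := by
    intro H H' e; subst e; rfl
  exact (cast ub60_HZ_eq_rowsZ).trans (rowMatrix_rowsZ BB.ub60 (LA := la60) (LB := lb60) ub60_obj_A ub60_obj_B)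

set_option maxRecDepth 100000 in
/-- `d^Z (BB.ub60) = 5` (from `UB60_UB26.dZ_eq`). -/
theorem ub60_dZ : BB.ub60.css.dZ = 5 :=
  (BB.ub60.dZ_eq_of_flat (D := UB60_UB26.cert.code (UB60_UB26.cert.commOK_of_checkStructure UB60_UB26.checkStructure_ok))
    ub60_rowMatrix_HX_eq ub60_rowMatrix_HZ_eq).symm.trans UB60_UB26.dZ_eq

set_option maxRecDepth 100000 in
/-- `k (BB.ub60) = 8` (from `UB60_UB26.k_eq`). -/
theorem ub60_k : BB.ub60.k = 8 :=
  (BB.ub60.k_eq_of_flat (D := UB60_UB26.cert.code (UB60_UB26.cert.commOK_of_checkStructure UB60_UB26.checkStructure_ok))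
    ub60_rowMatrix_HX_eq ub60_rowMatrix_HZ_eq).symm.trans UB60_UB26.k_eq

/-- **Rabeti–Mahdavifar §4: `UB(1 + x + x³ + x⁴, 5)` over `𝓡₃₀` has parameters `[[60, 8, 5]]`** (distance EXACT; `BB.HasParams`) —
the printed parameters REPRODUCED on the typed object `BB.ub60`. KERNEL. -/
theorem UB60_8_5_holds : Summit.Ventures.QEC.BB.HasParams BB.ub60 60 8 5 :=
  BB.hasParams_of_dZ (by simp only [BB.numQubits_eq]) ub60_k ub60_dZ

/-- The same in the generic census vocabulary: `BB.ub60.css.IsCode 60 8 5`. -/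
theorem ub60_isCode : BB.ub60.css.IsCode 60 8 5 :=
  (BB.hasParams_iff_isCode (by decide)).1 UB60_8_5_holds

end Summit.Ventures.QEC.Census.UB26Rows
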